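import Summits.Ventures.HodgeRepro2.T5InertUnipotentCongruence

/-!
# The congruence subgroups `K_{a,b}` of `K`
(cell pub-hodge-repro2, seat p3)

Tier-5 N3 support, towards the count `deg Tₙ = [K : K ∩ aₙ K aₙ⁻¹] = (q³ + 1) q^{4n−3}` of
T5-SATAKE-KERNEL-p3.md row 11 (continuation of file 195). For `a ≤ b ≤ 2a` the set
`K_{a,b} = {κ ∈ K : κ₀₁ ∈ ϖ^a R, κ₀₂ ∈ ϖ^b R, κ₁₂ ∈ ϖ^a R}` is a subgroup of `U(antidiag(1, u, 1))`:

* **`congSubgroup a b`** — the subgroup `K_{a,b}` (closure under products by the entry formulas, under inverses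
  by `g⁻¹ = J⁻¹ gᴴ J`: `inv_entries`), `K_{0,0} = K` (`congSubgroup_zero_zero`), monotone in `(a, b)`
  (`congSubgroup_le`), and file 193's stabiliser `K ∩ aₙ K aₙ⁻¹` of the cell `aₙ` is `K_{n,2n}`
  (**`inf_conjK_cellU_eq_congSubgroup`**);
* the unipotent radical inside: `N_{a,b} ≤ K_{a,b}` (`unipCong_le_congSubgroup`) and
  **`N_{a,b} ∩ K_{a',b'} = N_{a',b'}`** for `a ≤ a'`, `b ≤ b'` (`unipCong_inf_congSubgroup`);
* `relIndex_eq_of_forall_exists` — the general transfer `[H : H'] = [N : N ∩ H']` for `N ≤ H`, `H' ≤ H`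
  with `H ⊆ N · H'` (a bijection of coset spaces, no normality);
* `entry_zero_one_eq_zero` — in a unitary matrix the entry `(0, 1)` vanishes with `(0, 2)` and `(1, 2)`.

The next file (`T5InertIwahoriFactorisation`) proves `K_{a,b} = N_{a,b} · (K ∩ B⁻)` for `a ≥ 1` and
transports the indices: `[K_{a,b} : K_{a',b'}] = [N_{a,b} : N_{a',b'}]`.

Mathlib + this seat's files 193 / 195 and their imports; no display; no device.
§8(d): uses an L-value-free non-vanishing device: NO.
-/

namespace Summit.Ventures.HodgeRepro2.T5InertCongruenceSubgroups

open Matrix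
open Summit.Ventures.HodgeRepro2.T5CartanCellsDistinct Summit.Ventures.HodgeRepro2.T5HermitianThreeElements
  Summit.Ventures.HodgeRepro2.T5UnitaryGroupForm Summit.Ventures.HodgeRepro2.T5UnitaryThreeCorner
  Summit.Ventures.HodgeRepro2.T5UnitaryHeckeAdjoint Summit.Ventures.HodgeRepro2.T5HeckeBasisCells
  Summit.Ventures.HodgeRepro2.T5HeckeDegreeIndex Summit.Ventures.HodgeRepro2.T5InertTopCoefficientMatrix
  Summit.Ventures.HodgeRepro2.T5InertCongruenceSubgroup Summit.Ventures.HodgeRepro2.T5InertUnipotentCongruence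

/-! ## The transfer of an index along a factorisation `H = N · H'` -/

section Transfer

variable {G : Type*} [Group G]

/-- **Transfer of an index.** If `N ≤ H`, `H' ≤ H` and every `h ∈ H` is `ν h'` with `ν ∈ N`, `h' ∈ H'`, then
`[H : H'] = [N : N ∩ H']` (the coset spaces `N/(N ∩ H')` and `H/H'` are in bijection; no normality). -/
theorem relIndex_eq_of_forall_exists {H H' N : Subgroup G} (hN : N ≤ H)
    (hdec : ∀ h ∈ H, ∃ ν ∈ N, ν⁻¹ * h ∈ H') : H'.relIndex H = H'.relIndex N := by
  unfold Subgroup.relIndex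
  rw [Subgroup.index_eq_card, Subgroup.index_eq_card]
  symm
  refine Nat.card_congr (Equiv.ofBijective
    (Quotient.map' (fun ν : N => (⟨ν, hN ν.2⟩ : H)) (fun ν₁ ν₂ h => ?_)) ⟨?_, ?_⟩)
  · have h' := QuotientGroup.leftRel_apply.1 h
    refine QuotientGroup.leftRel_apply.2 ?_
    simpa only [Subgroup.mem_subgroupOf, Subgroup.coe_mul, Subgroup.coe_inv] using h'
  · intro x y
    induction x using QuotientGroup.induction_on with
    | H ν₁ =>
    induction y using QuotientGroup.induction_on with
    | H ν₂ =>
    intro hxy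
    have hxy' : ((⟨ν₁, hN ν₁.2⟩ : H) : H ⧸ H'.subgroupOf H) = ((⟨ν₂, hN ν₂.2⟩ : H) : H ⧸ H'.subgroupOf H) :=
      hxy
    rw [QuotientGroup.eq] at hxy' ⊢
    simpa only [Subgroup.mem_subgroupOf, Subgroup.coe_mul, Subgroup.coe_inv] using hxy'
  · intro y
    induction y using QuotientGroup.induction_on with
    | H h =>
    obtain ⟨ν, hν, hνh⟩ := hdec h h.2
    refine ⟨((⟨ν, hν⟩ : N) : N ⧸ H'.subgroupOf N), ?_⟩
    change ((⟨ν, hN hν⟩ : H) : H ⧸ H'.subgroupOf H) = (h : H ⧸ H'.subgroupOf H)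
    rw [QuotientGroup.eq, Subgroup.mem_subgroupOf]
    simpa only [Subgroup.coe_mul, Subgroup.coe_inv] using hνh

end Transfer

/-! ## The congruence subgroups `K_{a,b}` -/

section Cong

variable {R E : Type*} [CommRing R] [Field E] [StarRing E] [Algebra R E] [IsFractionRing R E]
  (hstar : ∀ x : E, IsLocalization.IsInteger R x → IsLocalization.IsInteger R (star x))
  (u : E) (hsu : star u = u) (hu0 : u ≠ 0) (hu : IsLocalization.IsInteger R u)
  (hu' : IsLocalization.IsInteger R u⁻¹)
  {ϖ : R} (hϖ : Irreducible ϖ) (hs : star (algebraMap R E ϖ) = algebraMap R E ϖ)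

omit [StarRing E] in
include hϖ in
/-- `π^{-a} = π^{-b} · π^{b−a}` for `a ≤ b`. -/
theorem zpow_neg_eq_mul_pow_sub {a b : ℕ} (hab : a ≤ b) :
    algebraMap R E ϖ ^ (-(a : ℤ)) = algebraMap R E ϖ ^ (-(b : ℤ)) * algebraMap R E ϖ ^ (b - a) := by
  have hπ0 : algebraMap R E ϖ ≠ 0 :=
    (map_ne_zero_iff _ (IsFractionRing.injective R E)).2 hϖ.ne_zero
  rw [← zpow_natCast, ← zpow_add₀ hπ0]
  congr 1
  push_cast [Nat.cast_sub hab]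
  ring

omit [StarRing E] in
include hϖ in
/-- `π^{-b} = π^{-a} · π^{-a} · π^{2a−b}` for `b ≤ 2a`. -/
theorem zpow_neg_eq_mul_mul_pow_sub {a b : ℕ} (hba : b ≤ 2 * a) :
    algebraMap R E ϖ ^ (-(b : ℤ)) =
      algebraMap R E ϖ ^ (-(a : ℤ)) * algebraMap R E ϖ ^ (-(a : ℤ)) * algebraMap R E ϖ ^ (2 * a - b) := by
  have hπ0 : algebraMap R E ϖ ≠ 0 :=
    (map_ne_zero_iff _ (IsFractionRing.injective R E)).2 hϖ.ne_zero
  rw [← zpow_natCast, ← zpow_add₀ hπ0, ← zpow_add₀ hπ0]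
  congr 1
  push_cast [Nat.cast_sub hba]
  ring

omit [IsFractionRing R E] in
include hstar hs in
/-- The star of a congruence entry: `IsInteger (y π^{-a}) → IsInteger (star y · π^{-a})`. -/
theorem isInteger_star_mul_zpow {y : E} {a : ℕ}
    (h : IsLocalization.IsInteger R (y * algebraMap R E ϖ ^ (-(a : ℤ)))) :
    IsLocalization.IsInteger R (star y * algebraMap R E ϖ ^ (-(a : ℤ))) := by
  have := hstar _ h
  rwa [star_mul, star_zpow₀, hs, mul_comm] at this

omit [StarRing E] [IsFractionRing R E] in
/-- A `3 × 3` matrix is the `!![…]` of its entries. -/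
theorem coe_eq_fin_three (g : GL (Fin 3) E) :
    (g : Matrix (Fin 3) (Fin 3) E) = !![(g : Matrix (Fin 3) (Fin 3) E) 0 0,
      (g : Matrix (Fin 3) (Fin 3) E) 0 1, (g : Matrix (Fin 3) (Fin 3) E) 0 2;
      (g : Matrix (Fin 3) (Fin 3) E) 1 0, (g : Matrix (Fin 3) (Fin 3) E) 1 1,
      (g : Matrix (Fin 3) (Fin 3) E) 1 2; (g : Matrix (Fin 3) (Fin 3) E) 2 0,
      (g : Matrix (Fin 3) (Fin 3) E) 2 1, (g : Matrix (Fin 3) (Fin 3) E) 2 2] := by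
  ext i j
  fin_cases i <;> fin_cases j <;> rfl

include hu0 in
/-- The three upper entries of `g⁻¹ = J⁻¹ gᴴ J` for `g ∈ U(antidiag(1, u, 1))`. -/
theorem inv_entries {g : GL (Fin 3) E} (hg : g ∈ formUnitaryGroup (J3 u)) :
    ((g⁻¹ : GL (Fin 3) E) : Matrix (Fin 3) (Fin 3) E) 0 1 = u * star ((g : Matrix (Fin 3) (Fin 3) E) 1 2) ∧
    ((g⁻¹ : GL (Fin 3) E) : Matrix (Fin 3) (Fin 3) E) 0 2 = star ((g : Matrix (Fin 3) (Fin 3) E) 0 2) ∧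
    ((g⁻¹ : GL (Fin 3) E) : Matrix (Fin 3) (Fin 3) E) 1 2 =
      u⁻¹ * star ((g : Matrix (Fin 3) (Fin 3) E) 0 1) := by
  rw [coe_inv_eq u hu0 g _ _ _ _ _ _ _ _ _ (coe_eq_fin_three g) hg]
  exact ⟨rfl, rfl, rfl⟩

/-- **`K_{a,b} = {κ ∈ K : κ₀₁ ∈ ϖ^a R, κ₀₂ ∈ ϖ^b R, κ₁₂ ∈ ϖ^a R}`**, a subgroup of `U(antidiag(1, u, 1))` for
`a ≤ b ≤ 2a`. -/
def congSubgroup (a b : ℕ) (hab : a ≤ b) (hba : b ≤ 2 * a) : Subgroup (formUnitaryGroup (J3 u)) where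
  carrier := {g | g ∈ hyperspecialSubgroup R (J3 u) ∧
    IsLocalization.IsInteger R
      (((g : GL (Fin 3) E) : Matrix (Fin 3) (Fin 3) E) 0 1 * algebraMap R E ϖ ^ (-(a : ℤ))) ∧
    IsLocalization.IsInteger R
      (((g : GL (Fin 3) E) : Matrix (Fin 3) (Fin 3) E) 0 2 * algebraMap R E ϖ ^ (-(b : ℤ))) ∧
    IsLocalization.IsInteger R
      (((g : GL (Fin 3) E) : Matrix (Fin 3) (Fin 3) E) 1 2 * algebraMap R E ϖ ^ (-(a : ℤ)))}
  one_mem' := by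
    refine ⟨Subgroup.one_mem _, ?_, ?_, ?_⟩ <;>
    · rw [OneMemClass.coe_one, Units.val_one, Matrix.one_apply_ne (by decide), zero_mul]
      exact ⟨0, map_zero _⟩
  mul_mem' := by
    rintro g g' ⟨hg, hg01, hg02, hg12⟩ ⟨hg', hg01', hg02', hg12'⟩
    have hgi := isInteger_apply_of_mem_range ((mem_hyperspecialSubgroup_iff R g).1 hg)
    have hgi' := isInteger_apply_of_mem_range ((mem_hyperspecialSubgroup_iff R g').1 hg')
    have hπba := zpow_neg_eq_mul_pow_sub (E := E) hϖ hab
    have hπ2ab := zpow_neg_eq_mul_mul_pow_sub (E := E) hϖ hba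
    have hπint : ∀ n : ℕ, IsLocalization.IsInteger R (algebraMap R E ϖ ^ n) := fun n =>
      isInteger_pow ϖ n
    refine ⟨Subgroup.mul_mem _ hg hg', ?_, ?_, ?_⟩
    · rw [Subgroup.coe_mul, Units.val_mul, Matrix.mul_apply, Fin.sum_univ_three]
      have : (((g : GL (Fin 3) E) : Matrix (Fin 3) (Fin 3) E) 0 0 *
            ((g' : GL (Fin 3) E) : Matrix (Fin 3) (Fin 3) E) 0 1 +
          ((g : GL (Fin 3) E) : Matrix (Fin 3) (Fin 3) E) 0 1 *
            ((g' : GL (Fin 3) E) : Matrix (Fin 3) (Fin 3) E) 1 1 +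
          ((g : GL (Fin 3) E) : Matrix (Fin 3) (Fin 3) E) 0 2 *
            ((g' : GL (Fin 3) E) : Matrix (Fin 3) (Fin 3) E) 2 1) * algebraMap R E ϖ ^ (-(a : ℤ)) =
          ((g : GL (Fin 3) E) : Matrix (Fin 3) (Fin 3) E) 0 0 *
            (((g' : GL (Fin 3) E) : Matrix (Fin 3) (Fin 3) E) 0 1 * algebraMap R E ϖ ^ (-(a : ℤ))) +
          (((g : GL (Fin 3) E) : Matrix (Fin 3) (Fin 3) E) 0 1 * algebraMap R E ϖ ^ (-(a : ℤ))) *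
            ((g' : GL (Fin 3) E) : Matrix (Fin 3) (Fin 3) E) 1 1 +
          (((g : GL (Fin 3) E) : Matrix (Fin 3) (Fin 3) E) 0 2 * algebraMap R E ϖ ^ (-(b : ℤ))) *
            (algebraMap R E ϖ ^ (b - a) * ((g' : GL (Fin 3) E) : Matrix (Fin 3) (Fin 3) E) 2 1) := by
        rw [hπba]
        ring
      rw [this]
      exact IsLocalization.isInteger_add (IsLocalization.isInteger_add
        (IsLocalization.isInteger_mul (hgi 0 0) hg01') (IsLocalization.isInteger_mul hg01 (hgi' 1 1)))
        (IsLocalization.isInteger_mul hg02 (IsLocalization.isInteger_mul (hπint _) (hgi' 2 1)))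
    · rw [Subgroup.coe_mul, Units.val_mul, Matrix.mul_apply, Fin.sum_univ_three]
      have : (((g : GL (Fin 3) E) : Matrix (Fin 3) (Fin 3) E) 0 0 *
            ((g' : GL (Fin 3) E) : Matrix (Fin 3) (Fin 3) E) 0 2 +
          ((g : GL (Fin 3) E) : Matrix (Fin 3) (Fin 3) E) 0 1 *
            ((g' : GL (Fin 3) E) : Matrix (Fin 3) (Fin 3) E) 1 2 +
          ((g : GL (Fin 3) E) : Matrix (Fin 3) (Fin 3) E) 0 2 *
            ((g' : GL (Fin 3) E) : Matrix (Fin 3) (Fin 3) E) 2 2) * algebraMap R E ϖ ^ (-(b : ℤ)) =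
          ((g : GL (Fin 3) E) : Matrix (Fin 3) (Fin 3) E) 0 0 *
            (((g' : GL (Fin 3) E) : Matrix (Fin 3) (Fin 3) E) 0 2 * algebraMap R E ϖ ^ (-(b : ℤ))) +
          (((g : GL (Fin 3) E) : Matrix (Fin 3) (Fin 3) E) 0 1 * algebraMap R E ϖ ^ (-(a : ℤ))) *
            ((((g' : GL (Fin 3) E) : Matrix (Fin 3) (Fin 3) E) 1 2 * algebraMap R E ϖ ^ (-(a : ℤ))) *
              algebraMap R E ϖ ^ (2 * a - b)) +
          (((g : GL (Fin 3) E) : Matrix (Fin 3) (Fin 3) E) 0 2 * algebraMap R E ϖ ^ (-(b : ℤ))) *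
            ((g' : GL (Fin 3) E) : Matrix (Fin 3) (Fin 3) E) 2 2 := by
        rw [hπ2ab]
        ring
      rw [this]
      exact IsLocalization.isInteger_add (IsLocalization.isInteger_add
        (IsLocalization.isInteger_mul (hgi 0 0) hg02')
        (IsLocalization.isInteger_mul hg01 (IsLocalization.isInteger_mul hg12' (hπint _))))
        (IsLocalization.isInteger_mul hg02 (hgi' 2 2))
    · rw [Subgroup.coe_mul, Units.val_mul, Matrix.mul_apply, Fin.sum_univ_three]
      have : (((g : GL (Fin 3) E) : Matrix (Fin 3) (Fin 3) E) 1 0 *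
            ((g' : GL (Fin 3) E) : Matrix (Fin 3) (Fin 3) E) 0 2 +
          ((g : GL (Fin 3) E) : Matrix (Fin 3) (Fin 3) E) 1 1 *
            ((g' : GL (Fin 3) E) : Matrix (Fin 3) (Fin 3) E) 1 2 +
          ((g : GL (Fin 3) E) : Matrix (Fin 3) (Fin 3) E) 1 2 *
            ((g' : GL (Fin 3) E) : Matrix (Fin 3) (Fin 3) E) 2 2) * algebraMap R E ϖ ^ (-(a : ℤ)) =
          ((g : GL (Fin 3) E) : Matrix (Fin 3) (Fin 3) E) 1 0 *
            ((((g' : GL (Fin 3) E) : Matrix (Fin 3) (Fin 3) E) 0 2 * algebraMap R E ϖ ^ (-(b : ℤ))) *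
              algebraMap R E ϖ ^ (b - a)) +
          ((g : GL (Fin 3) E) : Matrix (Fin 3) (Fin 3) E) 1 1 *
            (((g' : GL (Fin 3) E) : Matrix (Fin 3) (Fin 3) E) 1 2 * algebraMap R E ϖ ^ (-(a : ℤ))) +
          (((g : GL (Fin 3) E) : Matrix (Fin 3) (Fin 3) E) 1 2 * algebraMap R E ϖ ^ (-(a : ℤ))) *
            ((g' : GL (Fin 3) E) : Matrix (Fin 3) (Fin 3) E) 2 2 := by
        rw [hπba]
        ring
      rw [this]
      exact IsLocalization.isInteger_add (IsLocalization.isInteger_add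
        (IsLocalization.isInteger_mul (hgi 1 0) (IsLocalization.isInteger_mul hg02' (hπint _)))
        (IsLocalization.isInteger_mul (hgi 1 1) hg12')) (IsLocalization.isInteger_mul hg12 (hgi' 2 2))
  inv_mem' := by
    rintro g ⟨hg, hg01, hg02, hg12⟩
    obtain ⟨e01, e02, e12⟩ := inv_entries u hu0 g.2
    refine ⟨Subgroup.inv_mem _ hg, ?_, ?_, ?_⟩
    · rw [Subgroup.coe_inv, e01, mul_assoc]
      exact IsLocalization.isInteger_mul hu (isInteger_star_mul_zpow hstar hs hg12)
    · rw [Subgroup.coe_inv, e02]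
      exact isInteger_star_mul_zpow hstar hs hg02
    · rw [Subgroup.coe_inv, e12, mul_assoc]
      exact IsLocalization.isInteger_mul hu' (isInteger_star_mul_zpow hstar hs hg01)

variable {a b : ℕ} {hab : a ≤ b} {hba : b ≤ 2 * a}

/-- Membership in `K_{a,b}`. -/
theorem mem_congSubgroup_iff {g : formUnitaryGroup (J3 u)} :
    g ∈ congSubgroup hstar u hu0 hu hu' hϖ hs a b hab hba ↔
      g ∈ hyperspecialSubgroup R (J3 u) ∧
      IsLocalization.IsInteger R
        (((g : GL (Fin 3) E) : Matrix (Fin 3) (Fin 3) E) 0 1 * algebraMap R E ϖ ^ (-(a : ℤ))) ∧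
      IsLocalization.IsInteger R
        (((g : GL (Fin 3) E) : Matrix (Fin 3) (Fin 3) E) 0 2 * algebraMap R E ϖ ^ (-(b : ℤ))) ∧
      IsLocalization.IsInteger R
        (((g : GL (Fin 3) E) : Matrix (Fin 3) (Fin 3) E) 1 2 * algebraMap R E ϖ ^ (-(a : ℤ))) :=
  Iff.rfl

/-- `K_{a,b} ≤ K`. -/
theorem congSubgroup_le_hyperspecial :
    congSubgroup hstar u hu0 hu hu' hϖ hs a b hab hba ≤ hyperspecialSubgroup R (J3 u) :=
  fun _ hg => hg.1

/-- `K_{0,0} = K`. -/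
theorem congSubgroup_zero_zero :
    congSubgroup hstar u hu0 hu hu' hϖ hs 0 0 le_rfl le_rfl = hyperspecialSubgroup R (J3 u) := by
  ext g
  rw [mem_congSubgroup_iff]
  refine ⟨fun h => h.1, fun h => ⟨h, ?_, ?_, ?_⟩⟩ <;>
  · rw [Nat.cast_zero, neg_zero, zpow_zero, mul_one]
    exact isInteger_apply_of_mem_range ((mem_hyperspecialSubgroup_iff R g).1 h) _ _

/-- `K_{a',b'} ≤ K_{a,b}` for `a ≤ a'`, `b ≤ b'`. -/
theorem congSubgroup_le {a' b' : ℕ} {hab' : a' ≤ b'} {hba' : b' ≤ 2 * a'} (ha : a ≤ a') (hb : b ≤ b') :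
    congSubgroup hstar u hu0 hu hu' hϖ hs a' b' hab' hba' ≤
      congSubgroup hstar u hu0 hu hu' hϖ hs a b hab hba := by
  rintro g ⟨hg, hg01, hg02, hg12⟩
  refine ⟨hg, ?_, ?_, ?_⟩
  · rw [zpow_neg_eq_mul_pow_sub (E := E) hϖ ha, ← mul_assoc]
    exact IsLocalization.isInteger_mul hg01 (isInteger_pow ϖ _)
  · rw [zpow_neg_eq_mul_pow_sub (E := E) hϖ hb, ← mul_assoc]
    exact IsLocalization.isInteger_mul hg02 (isInteger_pow ϖ _)
  · rw [zpow_neg_eq_mul_pow_sub (E := E) hϖ ha, ← mul_assoc]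
    exact IsLocalization.isInteger_mul hg12 (isInteger_pow ϖ _)

/-- **`K ∩ aₙ K aₙ⁻¹ = K_{n,2n}`** (file 193's description of the stabiliser of the cell `aₙ`). -/
theorem inf_conjK_cellU_eq_congSubgroup (n : ℕ) :
    hyperspecialSubgroup R (J3 u) ⊓ conjK (hyperspecialSubgroup R (J3 u)) (cellU hϖ hs u n) =
      congSubgroup hstar u hu0 hu hu' hϖ hs n (2 * n) (Nat.le_mul_of_pos_left n Nat.zero_lt_two) le_rfl := by
  ext g
  rw [Subgroup.mem_inf, mem_congSubgroup_iff]
  constructor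
  · rintro ⟨hg, hc⟩
    exact ⟨hg, (mem_conjK_cellU_iff hstar u hu0 hu hu' hϖ hs n hg).1 hc⟩
  · rintro ⟨hg, h⟩
    exact ⟨hg, (mem_conjK_cellU_iff hstar u hu0 hu hu' hϖ hs n hg).2 h⟩

/-! ## The unipotent radical inside `K_{a,b}` -/

/-- A congruence unipotent `n(ϖ^a x, ϖ^b z)` lies in `K_{a',b'}` iff its coordinates lie in `ϖ^{a'} R`,
`ϖ^{b'} R`. -/
theorem upper3_cong_mem_congSubgroup_iff {a' b' : ℕ} {hab' : a' ≤ b'} {hba' : b' ≤ 2 * a'} (x z : R)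
    (hmem : upper3 u (algebraMap R E ϖ ^ a * algebraMap R E x) (algebraMap R E ϖ ^ b * algebraMap R E z) ∈
      formUnitaryGroup (J3 u)) :
    (⟨_, hmem⟩ : formUnitaryGroup (J3 u)) ∈ congSubgroup hstar u hu0 hu hu' hϖ hs a' b' hab' hba' ↔
      IsLocalization.IsInteger R (algebraMap R E ϖ ^ a * algebraMap R E x * algebraMap R E ϖ ^ (-(a' : ℤ))) ∧
      IsLocalization.IsInteger R
        (algebraMap R E ϖ ^ b * algebraMap R E z * algebraMap R E ϖ ^ (-(b' : ℤ))) := by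
  rw [mem_congSubgroup_iff]
  simp only [coe_upper3, Fin.isValue, Matrix.of_apply, Matrix.cons_val', Matrix.cons_val_zero,
    Matrix.cons_val_one, Matrix.cons_val_two, Matrix.tail_cons, Matrix.head_cons, Matrix.empty_val',
    Matrix.cons_val_fin_one]
  constructor
  · rintro ⟨-, h1, h2, -⟩
    exact ⟨h1, h2⟩
  · rintro ⟨h1, h2⟩
    refine ⟨?_, h1, h2, ?_⟩
    · rw [mem_hyperspecialSubgroup_iff]
      refine upper3_mem_range (IsLocalization.isInteger_mul (isInteger_pow ϖ a) ⟨x, rfl⟩)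
        (IsLocalization.isInteger_mul (isInteger_pow ϖ b) ⟨z, rfl⟩) ?_
      rw [div_eq_mul_inv]
      exact IsLocalization.isInteger_mul
        (hstar _ (IsLocalization.isInteger_mul (isInteger_pow ϖ a) ⟨x, rfl⟩)) hu'
    · rw [neg_div, neg_mul, div_eq_mul_inv, mul_right_comm]
      exact isInteger_neg (IsLocalization.isInteger_mul (isInteger_star_mul_zpow hstar hs h1) hu')

/-- `N_{a,b} ≤ K_{a,b}`. -/
theorem unipCong_le_congSubgroup :
    unipCong hstar u hu' hs a b hba ≤ congSubgroup hstar u hu0 hu hu' hϖ hs a b hab hba := by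
  rintro g ⟨x, z, hg⟩
  have hmem : upper3 u (algebraMap R E ϖ ^ a * algebraMap R E x)
      (algebraMap R E ϖ ^ b * algebraMap R E z) ∈ formUnitaryGroup (J3 u) := hg ▸ g.2
  have hg' : g = ⟨_, hmem⟩ := Subtype.ext hg
  rw [hg', upper3_cong_mem_congSubgroup_iff]
  have hπ0 : algebraMap R E ϖ ≠ 0 :=
    (map_ne_zero_iff _ (IsFractionRing.injective R E)).2 hϖ.ne_zero
  constructor
  · rw [mul_right_comm, ← zpow_natCast, ← zpow_add₀ hπ0, add_neg_cancel, zpow_zero, one_mul]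
    exact ⟨x, rfl⟩
  · rw [mul_right_comm, ← zpow_natCast, ← zpow_add₀ hπ0, add_neg_cancel, zpow_zero, one_mul]
    exact ⟨z, rfl⟩

/-- **`N_{a,b} ∩ K_{a',b'} = N_{a',b'}`** for `a ≤ a'`, `b ≤ b'`. -/
theorem unipCong_inf_congSubgroup {a' b' : ℕ} {hab' : a' ≤ b'} {hba' : b' ≤ 2 * a'} (ha : a ≤ a')
    (hb : b ≤ b') :
    unipCong hstar u hu' hs a b hba ⊓ congSubgroup hstar u hu0 hu hu' hϖ hs a' b' hab' hba' =
      unipCong hstar u hu' hs a' b' hba' := by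
  have hπ0 : algebraMap R E ϖ ≠ 0 :=
    (map_ne_zero_iff _ (IsFractionRing.injective R E)).2 hϖ.ne_zero
  ext g
  rw [Subgroup.mem_inf]
  constructor
  · rintro ⟨⟨x, z, hg⟩, hK⟩
    have hmem : upper3 u (algebraMap R E ϖ ^ a * algebraMap R E x)
        (algebraMap R E ϖ ^ b * algebraMap R E z) ∈ formUnitaryGroup (J3 u) := hg ▸ g.2
    have hg' : g = ⟨_, hmem⟩ := Subtype.ext hg
    rw [hg', upper3_cong_mem_congSubgroup_iff] at hK
    obtain ⟨⟨x', hx'⟩, ⟨z', hz'⟩⟩ := hK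
    refine ⟨x', z', ?_⟩
    rw [hg]
    congr 1
    · rw [hx', mul_comm (algebraMap R E ϖ ^ a'), mul_assoc, ← zpow_natCast (algebraMap R E ϖ) a',
        ← zpow_add₀ hπ0, neg_add_cancel, zpow_zero, mul_one]
    · rw [hz', mul_comm (algebraMap R E ϖ ^ b'), mul_assoc, ← zpow_natCast (algebraMap R E ϖ) b',
        ← zpow_add₀ hπ0, neg_add_cancel, zpow_zero, mul_one]
  · rintro ⟨x', z', hg⟩
    refine ⟨⟨ϖ ^ (a' - a) * x', ϖ ^ (b' - b) * z', ?_⟩, ?_⟩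
    · rw [hg, map_mul, map_mul, map_pow, map_pow, ← mul_assoc, ← mul_assoc, ← pow_add, ← pow_add,
        Nat.add_sub_cancel' ha, Nat.add_sub_cancel' hb]
    · exact unipCong_le_congSubgroup hstar u hu0 hu hu' hϖ hs (hab := hab') ⟨x', z', hg⟩

/-! ## The Iwahori factorisation `K_{a,b} = N_{a,b} · (K ∩ B⁻)` -/

/-- In a unitary matrix `g ∈ U(antidiag(1, u, 1))`, the entry `(0, 1)` vanishes as soon as the entries
`(0, 2)` and `(1, 2)` do (relations of the column pairs `(1, 2)` and `(0, 2)`). -/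
theorem entry_zero_one_eq_zero {g : GL (Fin 3) E} (hg : g ∈ formUnitaryGroup (J3 u))
    (h02 : (g : Matrix (Fin 3) (Fin 3) E) 0 2 = 0) (h12 : (g : Matrix (Fin 3) (Fin 3) E) 1 2 = 0) :
    (g : Matrix (Fin 3) (Fin 3) E) 0 1 = 0 := by
  have hrel := (mem_iff_fin_three u g _ _ _ _ _ _ _ _ _ (coe_eq_fin_three g)).1 hg
  have hc := hrel.2.2.1
  have hf := hrel.2.2.2.2.2.1
  simp only [h02, h12, mul_zero, zero_add] at hc hf
  have h22 : (g : Matrix (Fin 3) (Fin 3) E) 2 2 ≠ 0 := fun h => by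
    rw [h, mul_zero] at hc
    exact zero_ne_one hc
  have := (mul_eq_zero.1 hf).resolve_right h22
  rwa [star_eq_zero] at this

end Cong

end Summit.Ventures.HodgeRepro2.T5InertCongruenceSubgroups
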